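import Summits.HodgeConjecture.CorCM.MultiFieldWeilSimpleFamilies
import Summits.HodgeConjecture.CorCM.MultiFieldWeilAnyTwoSimpleThreefolds
import HarnessLib

/-!
# MULTI-FIELD WEIL ENGINE — SIMPLE FAMILIES WITHOUT THE CURVE: any number of SIMPLE CM threefolds and WEIL-TYPE CM fivefolds whose CM fields contain ONE
# imaginary quadratic field `k` and form cubic ∕ quintic towers over `k` — the Hodge conjecture for every product of copies of the threefolds and fivefolds
# themselves, given ONLY Markman's fourfold and hyperbolic-sixfold theorems

Cell `pub-hodgecm2` (COR-CM), seat b30 gen 33 (2026-08-24); count-neutral own lane MULTI-FIELD WEIL ENGINE (stem `MultiFieldWeil*`), sequel of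
`CorCM/MultiFieldWeilSimpleFamilies.lean` (the engine-form simple families, with the CM elliptic curve `E = A 0` of `k` as slot `0`).  Theorems only; no definition, no
named fact, no `sorry`.  HONEST FRAMING: conditional on the displayed Markman binders only; `HC_CM` is NOT proved and not asserted.

WHY.  Every headline of the engine is stated for a family `A : Fin (r + 1) → AbelianVariety ℂ` whose slot `0` is a CM elliptic curve `E ⊨ (k; {τ})` supplied by
the user; the products WITHOUT `E` are among the conclusions (`κ` avoiding `0`), but a reader holding only threefolds and fivefolds should not have to produce `E`.
As gen 31 did for two threefolds (`hodgeConjectureFor_biproduct_comp_vec_of_any_two_simpleThreefolds_of_markman`), the curve is produced INSIDE the proof: the CM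
type `{τ}` of the imaginary quadratic field `k = Kf i₀` (`exists_cmType_iff_eq`) is realised by some CM elliptic curve (the tree's `cmAbelianVarietyRealised_holds`
through `Domination.isCMTypeRealisation_cmCode`), the family `Fin.cons E T` is assembled (`exists_realisations_cons`) and the engine theorem is restricted to the
slots `≥ 1`.  What remains in the hypotheses is exactly: the fields (degrees, the embeddings `im m : k → K_m`, the tower condition for ONE family `s₀` of
`τ`-embeddings), the realisations of the `T_m` on `H¹`, and `IsSimple` (threefolds) ∕ the `k`-signature over `τ` (fivefolds).

* §1 `exists_cmType_iff_eq`, `exists_cmCurve_iff_eq` (a CM elliptic curve `E ⊨ (k; {τ})` for every embedding `τ` of an imaginary quadratic `k`),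
  `exists_realisations_cons` (the family `Fin.cons E T` with its dependent realisation data).
* §2 **`hodgeConjectureFor_biproduct_comp_of_simpleThreefolds_of_cubicTower_curveFree`** (+ dominated) — `k` imaginary quadratic, `T_m ⊨ (K_m; Φ_m)` (`m < r`)
  SIMPLE CM threefolds over sextic `K_m ⊇ im m (k)` in a cubic tower over `k`: the Hodge conjecture for EVERY `⨁_j T (κ j)` — every `∏ T_m^{b_m}` — GIVEN ONLY
  `Markman2025_weilClasses_algebraic_abelianFourfold`.
* §3 **`hodgeConjectureFor_biproduct_comp_of_weilFivefolds_of_quinticTower_curveFree`** (+ dominated) — Weil-type fivefolds over decic fields in a quintic tower, GIVEN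
  ONLY `Markman2025_weilClasses_algebraic_hyperbolicSixfold`.
* §4 **`hodgeConjectureFor_biproduct_comp_of_simpleThreefolds_weilFivefolds_of_towers_curveFree`** (+ dominated) — both together, each field avoiding the compositum of
  the earlier fields of the same degree, GIVEN ONLY the two Markman theorems.

[cite: Markman2025SurveySecant, Thm. 1.2] [cite: Markman2025SecantWeil, Thm 1.5.1] [cite: Shimura1998, §5.2, §6.2 Thm. 3, §8.2 Prop. 26, §8.4, §18.2 Lemma (i)]
[cite: Lang2002, VI §1 Thm. 1.1, Cor. 1.6 and V §2 Thm. 2.8]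

## References
* [Markman2025SurveySecant] E. Markman, arXiv:2509.23403, Thm. 1.2.  [Markman2025SecantWeil] E. Markman, arXiv:2502.03415, Thm 1.5.1.  [Shimura1998] G. Shimura,
  *Abelian varieties with complex multiplication and modular functions*, §5.2, §6.2 Thm. 3, §8.2 Prop. 26, §8.4, §18.2 Lemma (i).  [Lang2002] S. Lang, *Algebra*,
  GTM 211, V §2, VI §1.
-/

noncomputable section

open CategoryTheory CategoryTheory.Limits NumberField IntermediateField

namespace Summit.HodgeConjecture.CorCM.MultiFieldWeil

open Finset
open Literature.AlgebraicGeometry Literature.AlgebraicGeometry.Motives Literature.AlgebraicGeometry.HodgeTheory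
open Literature.AlgebraicGeometry.ComplexMultiplication (IsCMTypeRealisation)
open Literature.AlgebraicTopology.SingularHomology
open Literature.NumberTheory.ComplexMultiplication

open scoped Classical

/-! ## §1 The CM elliptic curve of `k` over a chosen embedding, and the family `Fin.cons E T` -/

section Curve

variable {F : Type} [Field F] [NumberField F] [IsCMField F]

/-- **The CM type `{τ}` of an imaginary quadratic field**: for every complex embedding `τ` there is a CM type whose only member is `τ` (the other embedding is
`τ̄ ≠ τ`). [cite: Shimura1998, §5.2] -/
theorem exists_cmType_iff_eq (hF2 : Module.finrank ℚ F = 2) (τ : F →+* ℂ) : ∃ Ψ : CMType F, ∀ σ : F →+* ℂ, σ ∈ Ψ.1 ↔ σ = τ := by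
  refine ⟨⟨{τ}, fun s => ?_⟩, fun σ => Iff.rfl⟩
  rcases QuarticCM.eq_or_eq_conjugate_of_quadratic hF2 τ s with rfl | rfl
  · exact ⟨fun _ h => QuarticCM.conjugate_ne s h, fun _ => rfl⟩
  · refine ⟨fun h => absurd h (QuarticCM.conjugate_ne τ), fun h => absurd ?_ h⟩
    show ComplexEmbedding.conjugate (ComplexEmbedding.conjugate τ) ∈ ({τ} : Set (F →+* ℂ))
    rw [ComplexEmbedding.involutive_conjugate F τ]
    rfl

/-- **A CM elliptic curve `E ⊨ (k; {τ})` for every embedding `τ` of an imaginary quadratic field `k`**: the CM type `{τ}` is realised on `H¹` of some complex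
abelian variety (the tree's `cmAbelianVarietyRealised_holds`, read over `k` by `Domination.isCMTypeRealisation_cmCode`). [cite: Shimura1998, §5.2 and §6.2 Thm. 3] -/
theorem exists_cmCurve_iff_eq (hF2 : Module.finrank ℚ F = 2) (τ : F →+* ℂ) :
    ∃ (Ψ : CMType F) (E : AbelianVariety ℂ) (ιE : 𝓞 F →+* End E) (θE : F →+* Module.End ℂ (complexBetti E.X 1)),
      IsCMTypeRealisation Ψ E ιE θE ∧ ∀ σ : F →+* ℂ, σ ∈ Ψ.1 ↔ σ = τ := by
  obtain ⟨Ψ, hΨ⟩ := exists_cmType_iff_eq hF2 τ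
  exact ⟨Ψ, _, _, _, Domination.isCMTypeRealisation_cmCode F cmAbelianVarietyRealised_holds Ψ, hΨ⟩

end Curve

section CurveFree

variable {I : Type} {r : ℕ} {Kf : I → Type} [∀ i, Field (Kf i)] [∀ i, NumberField (Kf i)] [∀ i, IsCMField (Kf i)]
  {i₀ : I} {is : Fin r → I}
  {T : Fin r → AbelianVariety ℂ} {ΦT : ∀ m : Fin r, CMType (Kf (is m))}
  {ιT : ∀ m, 𝓞 (Kf (is m)) →+* End (T m)} {θT : ∀ m, Kf (is m) →+* Module.End ℂ (complexBetti (T m).X 1)}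

omit [∀ i, IsCMField (Kf i)] in
/-- **The family `Fin.cons E T` with its realisation data.**  A realisation of `(k; Ψ)` on `E` (`k = Kf i₀`) and realisations of `(Kf (is m); ΦT m)` on the `T m`
assemble into dependent families `Φ, ι, θ` over the slots `mfSlots i₀ is = Fin.cons i₀ is`, realised on `Fin.cons E T`, with `Φ 0 = Ψ` and `Φ (m+1) = ΦT m`.
[folklore] -/
theorem exists_realisations_cons {Ψ : CMType (Kf i₀)} {E : AbelianVariety ℂ} {ιE : 𝓞 (Kf i₀) →+* End E}
    {θE : Kf i₀ →+* Module.End ℂ (complexBetti E.X 1)} (hE : IsCMTypeRealisation Ψ E ιE θE)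
    (hT : ∀ m, IsCMTypeRealisation (ΦT m) (T m) (ιT m) (θT m)) :
    ∃ (Φ : ∀ j : Fin (r + 1), CMType (Kf (mfSlots i₀ is j)))
      (ι : ∀ j, 𝓞 (Kf (mfSlots i₀ is j)) →+* End ((Fin.cons E T : Fin (r + 1) → AbelianVariety ℂ) j))
      (θ : ∀ j, Kf (mfSlots i₀ is j) →+* Module.End ℂ (complexBetti ((Fin.cons E T : Fin (r + 1) → AbelianVariety ℂ) j).X 1)),
      (∀ j, IsCMTypeRealisation (Φ j) ((Fin.cons E T : Fin (r + 1) → AbelianVariety ℂ) j) (ι j) (θ j)) ∧ Φ 0 = Ψ ∧ ∀ m : Fin r, Φ m.succ = ΦT m := by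
  refine ⟨Fin.cons Ψ ΦT, Fin.cons ιE ιT, Fin.cons θE θT, Fin.cases hE (fun m => ?_), rfl, fun m => rfl⟩
  exact hT m

omit [∀ i, NumberField (Kf i)] [∀ i, IsCMField (Kf i)] in
/-- Restricting a product of copies over `Fin.cons E T` to the slots `≥ 1` gives the product of copies of the `T m` (bookkeeping, definitional). [folklore] -/
theorem biproduct_cons_succ {E : AbelianVariety ℂ} {N : ℕ} (κ : Fin N → Fin r) :
    (fun j => (Fin.cons E T : Fin (r + 1) → AbelianVariety ℂ) (Fin.succ (κ j))) = fun j => T (κ j) :=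
  funext fun j => Fin.cons_succ (α := fun _ => AbelianVariety ℂ) E T (κ j)

/-! ## §2 Simple CM threefolds over a cubic tower — no curve in the statement -/

/-- **ANY NUMBER OF SIMPLE CM THREEFOLDS WHOSE SEXTIC CM FIELDS CONTAIN `k` AND FORM A CUBIC TOWER — given ONLY Markman's fourfold theorem; no curve in the
statement.**  `k = Kf i₀` imaginary quadratic with a chosen complex embedding `τ`; `T_m ⊨ (K_m; ΦT m)` (`m < r`) SIMPLE abelian threefolds with CM by SEXTIC
`K_m = Kf (is m) ⊇ im m (k)`, realised on `H¹` — nothing assumed on the types; `s₀` a family of `τ`-embeddings of the `K_m` such that for every `m` NO `τ`-embedding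
of `K_m` takes its values in `ℚ(τk) · s₀_0(K_0) ⋯ s₀_{m−1}(K_{m−1})` (no `k`-embedding of `K_m` into the compositum of the earlier fields; for `r = 2` this is
`Hom(K_1, K_0) = ∅`).  Then for every `κ : Fin N → Fin r` the Hodge conjecture holds for `⨁_j T (κ j)` — EVERY `T_0^{b_0} × ⋯ × T_{r−1}^{b_{r−1}}` — GIVEN ONLY
`Markman2025_weilClasses_algebraic_abelianFourfold`.  (A CM elliptic curve `E ⊨ (k; {τ})` is adjoined as slot `0`, `exists_cmCurve_iff_eq`, and
`hodgeConjectureFor_biproduct_comp_of_simpleThreefolds_of_cubicTower` is restricted to the slots `≥ 1`.)  `HC_CM` is NOT asserted. [cite: Markman2025SurveySecant, Thm. 1.2]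
[cite: Shimura1998, §6.2 Thm. 3, §8.2 Prop. 26, §8.4, §18.2 Lemma (i)] [cite: Lang2002, VI §1 Thm. 1.1, Cor. 1.6 and V §2 Thm. 2.8] -/
theorem hodgeConjectureFor_biproduct_comp_of_simpleThreefolds_of_cubicTower_curveFree (hW4 : Markman2025_weilClasses_algebraic_abelianFourfold)
    {N : ℕ} (κ : Fin N → Fin r) (h2 : Module.finrank ℚ (Kf i₀) = 2) (h6 : ∀ m : Fin r, Module.finrank ℚ (Kf (is m)) = 6)
    (im : ∀ m : Fin r, Kf i₀ →+* Kf (is m)) (hT : ∀ m, IsCMTypeRealisation (ΦT m) (T m) (ιT m) (θT m)) (hS : ∀ m, (T m).IsSimple)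
    (τ : Kf i₀ →+* ℂ) (s₀ : ∀ m : Fin r, Kf (is m) →+* ℂ) (hs₀ : ∀ m, (s₀ m).comp (im m) = τ)
    (htower : ∀ (m : Fin r) (φ : Kf (is m) →+* ℂ), φ.comp (im m) = τ →
      ¬ Set.range φ ⊆ (↑(adjoin ℚ (Set.range τ) ⊔ adjoin ℚ (⋃ j : {j : Fin r // j < m}, Set.range (s₀ j.1))) : Set ℂ)) :
    HodgeConjectureFor (⨁ fun j => T (κ j)).dim (⨁ fun j => T (κ j)).X := by
  obtain ⟨Ψ, E, ιE, θE, hE, hΨ⟩ := exists_cmCurve_iff_eq h2 τ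
  obtain ⟨Φ, ι, θ, hA, h0, -⟩ := exists_realisations_cons (is := is) hE hT
  have hΨ' : ∀ σ : Kf i₀ →+* ℂ, σ ∈ (Φ 0).1 ↔ σ = τ := by rw [h0]; exact hΨ
  have h := hodgeConjectureFor_biproduct_comp_of_simpleThreefolds_of_cubicTower hW4 (fun j => Fin.succ (κ j)) h2 h6 im hA hΨ' (fun m => hS m) s₀ hs₀ htower
  rw [biproduct_cons_succ κ] at h
  exact h

/-- **Dominated form**: everything dominated by a product of copies of the simple threefolds `T_m` (in particular `∏ T_m` itself, every abelian subvariety or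
quotient of a product of copies). [cite: Markman2025SurveySecant, Thm. 1.2] [cite: MumfordAV1970, §19 Thm. 1 and p. 169] -/
theorem hodgeConjectureFor_of_avDominatedBy_comp_of_simpleThreefolds_of_cubicTower_curveFree (hW4 : Markman2025_weilClasses_algebraic_abelianFourfold)
    {N : ℕ} (κ : Fin N → Fin r) (h2 : Module.finrank ℚ (Kf i₀) = 2) (h6 : ∀ m : Fin r, Module.finrank ℚ (Kf (is m)) = 6)
    (im : ∀ m : Fin r, Kf i₀ →+* Kf (is m)) (hT : ∀ m, IsCMTypeRealisation (ΦT m) (T m) (ιT m) (θT m)) (hS : ∀ m, (T m).IsSimple)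
    (τ : Kf i₀ →+* ℂ) (s₀ : ∀ m : Fin r, Kf (is m) →+* ℂ) (hs₀ : ∀ m, (s₀ m).comp (im m) = τ)
    (htower : ∀ (m : Fin r) (φ : Kf (is m) →+* ℂ), φ.comp (im m) = τ →
      ¬ Set.range φ ⊆ (↑(adjoin ℚ (Set.range τ) ⊔ adjoin ℚ (⋃ j : {j : Fin r // j < m}, Set.range (s₀ j.1))) : Set ℂ))
    {X : AbelianVariety ℂ} (hX : Domination.AVDominatedBy X (⨁ fun j => T (κ j))) : HodgeConjectureFor X.dim X.X :=
  Domination.hodgeConjectureFor_of_avDominatedBy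
    (hodgeConjectureFor_biproduct_comp_of_simpleThreefolds_of_cubicTower_curveFree hW4 κ h2 h6 im hT hS τ s₀ hs₀ htower) hX

/-! ## §3 Weil-type CM fivefolds over a quintic tower — no curve in the statement -/

/-- **ANY NUMBER OF WEIL-TYPE CM FIVEFOLDS WHOSE DECIC CM FIELDS CONTAIN `k` AND FORM A QUINTIC TOWER — given ONLY Markman's hyperbolic-sixfold theorem; no
curve in the statement.**  `k = Kf i₀` imaginary quadratic with a chosen embedding `τ`; `F_m ⊨ (K_m; ΦT m)` (`m < r`) abelian fivefolds with CM by DECIC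
`K_m = Kf (is m) ⊇ im m (k)` whose types have TWO OR THREE members over `τ` (`k`-signature `(2,3)`/`(3,2)`, Weil type); `s₀` a family of `τ`-embeddings with the
quintic tower condition (no `k`-embedding of `K_m` into the compositum of the earlier fields).  Then for every `κ : Fin N → Fin r` the Hodge conjecture holds for
`⨁_j F (κ j)` — every `∏ F_m^{c_m}` — GIVEN ONLY `Markman2025_weilClasses_algebraic_hyperbolicSixfold`.  The `(1,4)`-fivefolds are NOT covered.  `HC_CM` is NOT
asserted. [cite: Markman2025SecantWeil, Thm 1.5.1] [cite: Shimura1998, §6.2 Thm. 3, §18.2 Lemma (i)] [cite: Lang2002, VI §1 Thm. 1.1, Cor. 1.6 and V §2 Thm. 2.8] -/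
theorem hodgeConjectureFor_biproduct_comp_of_weilFivefolds_of_quinticTower_curveFree (hM6 : Markman2025_weilClasses_algebraic_hyperbolicSixfold)
    {N : ℕ} (κ : Fin N → Fin r) (h2 : Module.finrank ℚ (Kf i₀) = 2) (h10 : ∀ m : Fin r, Module.finrank ℚ (Kf (is m)) = 10)
    (im : ∀ m : Fin r, Kf i₀ →+* Kf (is m)) (hT : ∀ m, IsCMTypeRealisation (ΦT m) (T m) (ιT m) (θT m)) (τ : Kf i₀ →+* ℂ)
    (h23 : ∀ m : Fin r, (Finset.univ.filter fun s : Kf (is m) →+* ℂ => s.comp (im m) = τ ∧ s ∈ (ΦT m).1).card = 2 ∨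
      (Finset.univ.filter fun s : Kf (is m) →+* ℂ => s.comp (im m) = τ ∧ s ∈ (ΦT m).1).card = 3)
    (s₀ : ∀ m : Fin r, Kf (is m) →+* ℂ) (hs₀ : ∀ m, (s₀ m).comp (im m) = τ)
    (htower : ∀ (m : Fin r) (φ : Kf (is m) →+* ℂ), φ.comp (im m) = τ →
      ¬ Set.range φ ⊆ (↑(adjoin ℚ (Set.range τ) ⊔ adjoin ℚ (⋃ j : {j : Fin r // j < m}, Set.range (s₀ j.1))) : Set ℂ)) :
    HodgeConjectureFor (⨁ fun j => T (κ j)).dim (⨁ fun j => T (κ j)).X := by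
  obtain ⟨Ψ, E, ιE, θE, hE, hΨ⟩ := exists_cmCurve_iff_eq h2 τ
  obtain ⟨Φ, ι, θ, hA, h0, hsucc⟩ := exists_realisations_cons (is := is) hE hT
  have hΨ' : ∀ σ : Kf i₀ →+* ℂ, σ ∈ (Φ 0).1 ↔ σ = τ := by rw [h0]; exact hΨ
  have h23' : ∀ m : Fin r, (Finset.univ.filter fun s : Kf (is m) →+* ℂ => s.comp (im m) = τ ∧ s ∈ (Φ m.succ).1).card = 2 ∨
      (Finset.univ.filter fun s : Kf (is m) →+* ℂ => s.comp (im m) = τ ∧ s ∈ (Φ m.succ).1).card = 3 := fun m => by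
    rw [hsucc m]; exact h23 m
  have h := hodgeConjectureFor_biproduct_comp_of_weilFivefolds_of_quinticTower hM6 (fun j => Fin.succ (κ j)) h2 h10 im hA hΨ' h23' s₀ hs₀ htower
  rw [biproduct_cons_succ κ] at h
  exact h

/-- **Dominated form** of `hodgeConjectureFor_biproduct_comp_of_weilFivefolds_of_quinticTower_curveFree`. [cite: Markman2025SecantWeil, Thm 1.5.1]
[cite: MumfordAV1970, §19 Thm. 1 and p. 169] -/
theorem hodgeConjectureFor_of_avDominatedBy_comp_of_weilFivefolds_of_quinticTower_curveFree (hM6 : Markman2025_weilClasses_algebraic_hyperbolicSixfold)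
    {N : ℕ} (κ : Fin N → Fin r) (h2 : Module.finrank ℚ (Kf i₀) = 2) (h10 : ∀ m : Fin r, Module.finrank ℚ (Kf (is m)) = 10)
    (im : ∀ m : Fin r, Kf i₀ →+* Kf (is m)) (hT : ∀ m, IsCMTypeRealisation (ΦT m) (T m) (ιT m) (θT m)) (τ : Kf i₀ →+* ℂ)
    (h23 : ∀ m : Fin r, (Finset.univ.filter fun s : Kf (is m) →+* ℂ => s.comp (im m) = τ ∧ s ∈ (ΦT m).1).card = 2 ∨
      (Finset.univ.filter fun s : Kf (is m) →+* ℂ => s.comp (im m) = τ ∧ s ∈ (ΦT m).1).card = 3)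
    (s₀ : ∀ m : Fin r, Kf (is m) →+* ℂ) (hs₀ : ∀ m, (s₀ m).comp (im m) = τ)
    (htower : ∀ (m : Fin r) (φ : Kf (is m) →+* ℂ), φ.comp (im m) = τ →
      ¬ Set.range φ ⊆ (↑(adjoin ℚ (Set.range τ) ⊔ adjoin ℚ (⋃ j : {j : Fin r // j < m}, Set.range (s₀ j.1))) : Set ℂ))
    {X : AbelianVariety ℂ} (hX : Domination.AVDominatedBy X (⨁ fun j => T (κ j))) : HodgeConjectureFor X.dim X.X :=
  Domination.hodgeConjectureFor_of_avDominatedBy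
    (hodgeConjectureFor_biproduct_comp_of_weilFivefolds_of_quinticTower_curveFree hM6 κ h2 h10 im hT τ h23 s₀ hs₀ htower) hX

/-! ## §4 Simple threefolds and Weil-type fivefolds together — no curve in the statement -/

/-- **SIMPLE CM THREEFOLDS AND WEIL-TYPE CM FIVEFOLDS TOGETHER, all CM fields containing `k` — given ONLY Markman's two theorems; no curve in the statement.**
`k = Kf i₀` imaginary quadratic with a chosen embedding `τ`; for `m < r`, `K_m = Kf (is m) ⊇ im m (k)` of degree `2 n_m`, `n_m ∈ {3, 5}`, and `T_m ⊨ (K_m; ΦT m)`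
is, when `n_m = 3`, a SIMPLE abelian threefold (nothing assumed on its type) and, when `n_m = 5`, a fivefold whose type has two or three members over `τ` (Weil type);
`s₀` a family of `τ`-embeddings such that for every `m` NO `τ`-embedding of `K_m` has image inside `ℚ(τk) · ∏_{j < m, n_j = n_m} s₀_j(K_j)` (no `k`-embedding of
`K_m` into the compositum of the EARLIER fields OF THE SAME DEGREE).  Then for every `κ : Fin N → Fin r` the Hodge conjecture holds for `⨁_j T (κ j)` — every
`∏ T_m^{b_m}` — GIVEN ONLY `Markman2025_weilClasses_algebraic_abelianFourfold` and `Markman2025_weilClasses_algebraic_hyperbolicSixfold`.  `HC_CM` is NOT asserted.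
[cite: Markman2025SurveySecant, Thm. 1.2] [cite: Markman2025SecantWeil, Thm 1.5.1] [cite: Shimura1998, §6.2 Thm. 3, §8.2 Prop. 26, §8.4, §18.2 Lemma (i)]
[cite: Lang2002, VI §1 Thm. 1.1, Cor. 1.6 and V §2 Thm. 2.8] -/
theorem hodgeConjectureFor_biproduct_comp_of_simpleThreefolds_weilFivefolds_of_towers_curveFree (hW4 : Markman2025_weilClasses_algebraic_abelianFourfold)
    (hM6 : Markman2025_weilClasses_algebraic_hyperbolicSixfold) (n : Fin r → ℕ) (hn : ∀ m, n m = 3 ∨ n m = 5)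
    {N : ℕ} (κ : Fin N → Fin r) (h2 : Module.finrank ℚ (Kf i₀) = 2) (hdeg : ∀ m : Fin r, Module.finrank ℚ (Kf (is m)) = 2 * n m)
    (im : ∀ m : Fin r, Kf i₀ →+* Kf (is m)) (hT : ∀ m, IsCMTypeRealisation (ΦT m) (T m) (ιT m) (θT m)) (τ : Kf i₀ →+* ℂ)
    (hS : ∀ m : Fin r, n m = 3 → (T m).IsSimple)
    (h23 : ∀ m : Fin r, n m = 5 → (Finset.univ.filter fun s : Kf (is m) →+* ℂ => s.comp (im m) = τ ∧ s ∈ (ΦT m).1).card = 2 ∨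
      (Finset.univ.filter fun s : Kf (is m) →+* ℂ => s.comp (im m) = τ ∧ s ∈ (ΦT m).1).card = 3)
    (s₀ : ∀ m : Fin r, Kf (is m) →+* ℂ) (hs₀ : ∀ m, (s₀ m).comp (im m) = τ)
    (htower : ∀ (m : Fin r) (φ : Kf (is m) →+* ℂ), φ.comp (im m) = τ →
      ¬ Set.range φ ⊆ (↑(adjoin ℚ (Set.range τ) ⊔
        adjoin ℚ (⋃ j ∈ (Finset.univ.filter fun j : Fin r => n j = n m).filter (· < m), Set.range (s₀ j))) : Set ℂ)) :
    HodgeConjectureFor (⨁ fun j => T (κ j)).dim (⨁ fun j => T (κ j)).X := by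
  obtain ⟨Ψ, E, ιE, θE, hE, hΨ⟩ := exists_cmCurve_iff_eq h2 τ
  obtain ⟨Φ, ι, θ, hA, h0, hsucc⟩ := exists_realisations_cons (is := is) hE hT
  have hΨ' : ∀ σ : Kf i₀ →+* ℂ, σ ∈ (Φ 0).1 ↔ σ = τ := by rw [h0]; exact hΨ
  have h23' : ∀ m : Fin r, n m = 5 → (Finset.univ.filter fun s : Kf (is m) →+* ℂ => s.comp (im m) = τ ∧ s ∈ (Φ m.succ).1).card = 2 ∨
      (Finset.univ.filter fun s : Kf (is m) →+* ℂ => s.comp (im m) = τ ∧ s ∈ (Φ m.succ).1).card = 3 := fun m h5 => by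
    rw [hsucc m]; exact h23 m h5
  have h := hodgeConjectureFor_biproduct_comp_of_simpleThreefolds_weilFivefolds_of_towers hW4 hM6 n hn (fun j => Fin.succ (κ j)) h2 hdeg im hA hΨ'
    (fun m h3 => hS m h3) h23' s₀ hs₀ htower
  rw [biproduct_cons_succ κ] at h
  exact h

/-- **Dominated form** of `hodgeConjectureFor_biproduct_comp_of_simpleThreefolds_weilFivefolds_of_towers_curveFree`. [cite: Markman2025SurveySecant, Thm. 1.2]
[cite: Markman2025SecantWeil, Thm 1.5.1] [cite: MumfordAV1970, §19 Thm. 1 and p. 169] -/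
theorem hodgeConjectureFor_of_avDominatedBy_comp_of_simpleThreefolds_weilFivefolds_of_towers_curveFree
    (hW4 : Markman2025_weilClasses_algebraic_abelianFourfold) (hM6 : Markman2025_weilClasses_algebraic_hyperbolicSixfold) (n : Fin r → ℕ)
    (hn : ∀ m, n m = 3 ∨ n m = 5) {N : ℕ} (κ : Fin N → Fin r) (h2 : Module.finrank ℚ (Kf i₀) = 2)
    (hdeg : ∀ m : Fin r, Module.finrank ℚ (Kf (is m)) = 2 * n m) (im : ∀ m : Fin r, Kf i₀ →+* Kf (is m))
    (hT : ∀ m, IsCMTypeRealisation (ΦT m) (T m) (ιT m) (θT m)) (τ : Kf i₀ →+* ℂ) (hS : ∀ m : Fin r, n m = 3 → (T m).IsSimple)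
    (h23 : ∀ m : Fin r, n m = 5 → (Finset.univ.filter fun s : Kf (is m) →+* ℂ => s.comp (im m) = τ ∧ s ∈ (ΦT m).1).card = 2 ∨
      (Finset.univ.filter fun s : Kf (is m) →+* ℂ => s.comp (im m) = τ ∧ s ∈ (ΦT m).1).card = 3)
    (s₀ : ∀ m : Fin r, Kf (is m) →+* ℂ) (hs₀ : ∀ m, (s₀ m).comp (im m) = τ)
    (htower : ∀ (m : Fin r) (φ : Kf (is m) →+* ℂ), φ.comp (im m) = τ →
      ¬ Set.range φ ⊆ (↑(adjoin ℚ (Set.range τ) ⊔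
        adjoin ℚ (⋃ j ∈ (Finset.univ.filter fun j : Fin r => n j = n m).filter (· < m), Set.range (s₀ j))) : Set ℂ))
    {X : AbelianVariety ℂ} (hX : Domination.AVDominatedBy X (⨁ fun j => T (κ j))) : HodgeConjectureFor X.dim X.X :=
  Domination.hodgeConjectureFor_of_avDominatedBy
    (hodgeConjectureFor_biproduct_comp_of_simpleThreefolds_weilFivefolds_of_towers_curveFree hW4 hM6 n hn κ h2 hdeg im hT τ hS h23 s₀ hs₀ htower) hX

end CurveFree

end Summit.HodgeConjecture.CorCM.MultiFieldWeil

end
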